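/-
Copyright (c) 2026 the pub-hodgecm-mathlib formalisation cell (harness21).  Prover seat hodgecm-mathlib-K2E3-p29 (g0), HCML Track B «K2-LIT» (build stream 29),
h413 = `stmt-HodgeConjecture-24833`, line `K2_E3_EllipticInputs`, unit U12 «Characters», PART «SC» leaf (SC-an)₂ (road «FC₂», CLOSE-OUT DAY strike line L4 `stub_StCharTS`,
LINE-LEAD K2E3-plan (g4) deal D145 (L4 EMIT #3), architect K2E3-p25 (g3), binder desk K2E3-p23 (g7)): the `Fin 2` twin of ★ [M6′] FILE C `K2E3SupercuspidalTruncatedCharSplitBallPlace`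
— the EXPLICIT localisation and the SPLIT-REGULAR BALL BOUND on `U(1,1)(L⁺_v) = (cmDatum L 2 H).Local v` as the explicit shell weight `C·M·(2(12m_θ + 208h + 80τ + 1) + 1)·q^h·T⁻¹`,
HYPOTHESIS-FIRST over two letters: `hRD` (the [M6′]₂ FILE A radius datum, ★ `K2E3SupercuspidalTruncatedCharLimCancExplicitTwo`'s own letter, passed through) and `hSHELL`
(the (M5e-1‴)₂ split shell bound AT THE PLACE — the `Fin 2` twin of ★ `K2E3SupercuspidalTruncatedCharWeightKit` §1, payable by `…BallBoundSplitAssemblyTwo` (K2E3-p34 D150)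
+ the split-torus trio₂ (K2E3-p28 D143) + ★ [M2a]₂ once they are ★).  2026-09-04.
-/
import Summits.HodgeConjecture.HodgeConjecture.Theorems.K2E3SupercuspidalTruncatedCharLimCancExplicitTwo  -- ★ [M6′]₂ FILE B (K2E1-p10 D144): `exists_explicit_exhaustion_radius` (hypothesis-first on `hRD`); brings ★ [M2a]₂, ★ SingularLocusNull₂, ★ [M5′], ★ (f1)
import Summits.HodgeConjecture.HodgeConjecture.Theorems.K2E3ConjugatorHeightControlRankOneTwo        -- ★ (D2)₂ p861205 (K2E3-p34): `mem_heightBall_torus_of_conj_mem` (`y t y⁻¹ ∈ Ω_m ⇒ t ∈ Ω_m`, `2 × 2`)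
import Summits.HodgeConjecture.HodgeConjecture.Theorems.K2E3SplitTorusDepthFromDiscriminantTwo         -- ★ (M5e-2)₂ p861199 (K2E3-p33): `v_pow_le_v_sub_of_pow_normAbs_le_token` (depth `≤ 4τ + 4m` from the token)
import HarnessLib

/-!
# h413 ∕ Track B «K2-LIT», line `K2_E3_EllipticInputs`, unit U12, PART «SC», leaf (SC-an)₂ — [M6′]₂ FILE C: THE SPLIT-REGULAR BALL BOUND ON `U(1,1)(L⁺_v)` FOR THE
# EXPLICIT BALL `Bset g = e⁻¹(Ω_M (R g))`, AS AN EXPLICIT SHELL WEIGHT `C·M·(2(12m_θ + 208 h(e g) + 80τ + 1) + 1)·q^{h(e g)}·T(e g)⁻¹`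
# (Harish-Chandra 1970, Part VII §3 pp. 71–72, Theorems 14, 18–20, at rank one)

Cell `pub/hodgecm-mathlib`, crux H413 = `stmt-HodgeConjecture-24833`, route of record `HCCMUnconditional`; chair K2-lead (g2), LINE-LEAD ∕ dealer K2E3-plan (g4) (deal D145, L4 EMIT #3
2026-09-04T15:02:09Z; this seat's R0 15:08:32Z), (M5h)₂ payer K2E3-p23 (g7) (its `hSHELL` letter is THIS head, ∀-closed), chain desk K2E3-p27 (g0).
THEOREMS ONLY (no `def`, no `instance`, no `notation`, no named-fact `def … : Prop` hypothesis, no `sorry`); lane `--supports stmt-HodgeConjecture-24833 --as helper`, count-neutral.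

WHAT.  Along a field model `e : G = (cmDatum L 2 H).Local v ≃ₜ* M = U(σ_w, Φ₂)(L_w)` with height balls `Ω_M` (INPUT, `hmem`), for `θ = B u′ (ρ(·) u)` a smooth supercuspidal coefficient on
`G` and `μ` Haar: the objects of ★ [M6′]₂ FILE B (`Ω = e⁻¹ Ω_M`, the radius `R`, the support height `m_θ`, `F`, `Bset g = e⁻¹(Ω_M (R g))`, with `hlim`∕`hcanc` of ★ p856184 ∕ ★ p856355
token for token, a.e. regularity of `e g`, `hball_of_model_bound`, `hballE_of_model_bound`) TOGETHER WITH constants `C, M : ℝ≥0` (`‖θ_M‖ ≤ M`) and the **SPLIT BALL BOUND ON `G`**: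
for EVERY `g` with `e g` regular and `Z_G(g)` NOT compact, and every shell index `τ` with `‖ϖ‖^τ ≤ T(e g)` (`T = √√(|disc χ|·|det|⁻²)`, the chain's frozen token),
  `∫_{Bset g} ‖θ(x g x⁻¹)‖ dμ ≤ C · M · (2(12 m_θ + 208 h + 80 τ + 1) + 1) · q^{h} · T(e g)⁻¹`,   `h := Ω_M.find (e g)`.
HOW (the template's proof, token for token, over two letters).  ★ [M6′]₂ FILE B's datum `(t, d, y₀, λ_min, m_g)` at `e g` (`m_g = h` by minimality;
`R g = 5(2m_θ + 2λ_min) + 3(2m_g + 2λ_min) + 1`, from the letter `hRD` = [M6′]₂ FILE A `…RadiusDatumTwo.exists_radius_and_datum`'s conclusion ∀-closed, K2E1-p10's text VERBATIM);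
on the shell, `t ∈ Ω_{m_g}` (★ (D2)₂ `mem_heightBall_torus_of_conj_mem`) so `|ϖ^{m_g} dᵢ⁻¹| ≤ 1`, and ★ (M5e-2)₂ `v_pow_le_v_sub_of_pow_normAbs_le_token` gives the RANK-ONE depth
`λ_min ≤ 4τ + 4m_g` (the `N = 3` template has `4τ + 10m_g`), whence `R g + 42m_g + 2m_θ + 16τ ≤ 12m_θ + 112m_g + 80τ + 1 ≤ 12m_θ + 208m_g + 80τ + 1` — the constant is FROZEN at
the `N = 3` value `208` so that the consumer's letter (K2E3-p23's `hSHELL`, the `Fin 3 ↦ Fin 2` image of the template head) is met token for token; the letter `hSHELL` = the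
(M5e-1‴)₂ shell bound AT THE PLACE for `(e_* μ, Ω_M, m_θ)` (the `Fin 2` twin of ★ `K2E3SupercuspidalTruncatedCharWeightKit.exists_const_integral_heightBall_norm_conj_le_shell_place`'s
conclusion with the frozen constants `42m`, `16τ`, quantified over the Haar measure and `m_θ` only; its payer discharges `hunimod`, `K₁ hKB`, `ρ_T`, `μQ ≠ 0`, `σ_w ≠ id` at `L_w`
from K2E3-p34's D150 `…BallBoundSplitAssemblyTwo.exists_const_integral_heightBall_norm_conj_le_shell_frozen` + K2E3-p28's D143 trio₂ + ★ [M2a]₂, exactly as the template's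
§1 did at `N = 3`); transport `G ← M` by ★ [M6′]₂ FILE B (f).  Compared with the template the INPUT binders `hinv`, `hmul` are dropped (they only fed the shell lemma, now
inside `hSHELL`'s payer).

* **`explicit_localisation_and_split_ball_bound`** — the single ∃-statement above (one choice of `Ω R m_θ F Bset C M` for all clauses).

HONEST LABEL.  HC_CM is proved only modulo the 7 printed citations (2 remaining named inputs: hLiu418 = `stmt-HodgeConjecture-24832`, h413 = `stmt-HodgeConjecture-24833`)
until rung 0 closes; count-neutral helper; CONDITIONAL on the two letters `hRD`, `hSHELL` until their payers land; (SC-an)₂ is NOT ★.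

## References
* [HarishChandra1970] Harish-Chandra (notes by G. van Dijk), *Harmonic Analysis on Reductive p-adic Groups*, LNM 162 (1970), Part VI §8 Theorem 14 p. 60; Part VII §2 p. 69,
  Theorems 18–20 pp. 69–70; §3 pp. 71–72.
* [Rogawski1990] J. D. Rogawski, *Automorphic Representations of Unitary Groups in Three Variables*, Ann. of Math. Stud. 123 (1990), §1.9 p. 13, §3.1 p. 19, §4.9 p. 54, §12.2 p. 173.
* [DeitmarEchterhoff2014] A. Deitmar, S. Echterhoff, *Principles of Harmonic Analysis*, 2nd ed. (2014), Thm. 1.5.3.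
* [Folland1995] G. B. Folland, *A Course in Abstract Harmonic Analysis* (1995), §2.4, §2.6.
-/

set_option autoImplicit false
-- the mandated namespace repeats the single-problem summit's segment (`HodgeConjecture.HodgeConjecture`)
set_option linter.dupNamespace false

noncomputable section

open MeasureTheory Measure Set Filter Topology NumberField IsDedekindDomain
open scoped NNReal ENNReal Pointwise Matrix MatrixGroups WithZero
open ValuativeRel
open Literature.NumberTheory.Automorphic Literature.NumberTheory.Automorphic.UnitaryGroup Literature.NumberTheory.Rogawski1990
open Literature.NumberTheory.GaloisRepresentations Literature.NumberTheory.GaloisRepresentations.IsNonarchimedeanLocalField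

namespace Summit.HodgeConjecture.HodgeConjecture.Cruxes.H413.K2E3SupercuspidalTruncatedCharSplitBallPlaceTwo

variable (L : Type) [Field L] [NumberField L] [IsCMField L] (H : Matrix (Fin 2) (Fin 2) L)

set_option maxHeartbeats 800000 in
-- the statement is long (eleven exported clauses on the CM ∕ one-place carriers plus two ∀-closed letters); default budget runs out in its elaboration (same class as the ★ template)
/-- **[M6′]₂ FILE C — THE EXPLICIT LOCALISATION TOGETHER WITH THE SPLIT-REGULAR BALL BOUND AS AN EXPLICIT SHELL WEIGHT, TWO VARIABLES.**  Along
`e : (cmDatum L 2 H).Local v ≃ₜ* U(σ_w, Φ₂)(L_w)` with height balls `Ω_M` (`hmem`), for a smooth supercuspidal `ρ` with invariant `B`, `θ = B u′ (ρ(·) u)`, `θ_M = θ ∘ e⁻¹`, and `μ` Haar,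
GIVEN the letters `hRD` ([M6′]₂ FILE A radius datum, ∀-closed) and `hSHELL` ((M5e-1‴)₂ shell bound at the place, frozen constants `42m`, `16τ`, ∀-closed over the Haar measure and
the support height): ONE choice of `Ω (= e⁻¹ Ω_M)`, `R`, `m_θ`, `F`, `Bset (= e⁻¹(Ω_M (R ·)))`, `C`, `M` with — `hBsetc`, `hlim`, `hcanc` (★ p856184 ∕ ★ p856355 token for token),
`supp θ_M ⊆ Ω_M m_θ`, `‖θ_M‖₊ ≤ M`, `e g` regular a.e., `hball_of_model_bound` ∕ `hballE_of_model_bound` (`W := W_M ∘ e`), AND **the split ball bound**: for every `g` with `e g` regular and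
`Z_G(g)` not compact and every `τ` with `‖ϖ‖^τ ≤ T(e g)`, `∫_{Bset g} ‖θ(x g x⁻¹)‖ dμ ≤ C·M·(2(12m_θ + 208·h + 80τ + 1) + 1)·q^{h}·T(e g)⁻¹`, `h = Ω_M.find (e g)` (rank-one depth
`λ ≤ 4τ + 4m_g`, ★ (M5e-2)₂, then the `N = 3` constant `208 ≥ 112` frozen).  The `Fin 2` twin of ★ `K2E3SupercuspidalTruncatedCharSplitBallPlace.explicit_localisation_and_split_ball_bound`.
[cite: HarishChandra1970, Part VII §3 pp. 71–72; §2 Theorems 18–20 pp. 69–70; Part VI §8 Theorem 14 p. 60] [cite: Rogawski1990, §4.9 p. 54, §12.2 p. 173] [cite: DeitmarEchterhoff2014, Thm. 1.5.3] -/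
theorem explicit_localisation_and_split_ball_bound
    {v : HeightOneSpectrum (𝓞 ↥(maximalRealSubfield L))} (w : PlacesOver L v) (hw : IsCMField.complexConj L • w.1 = w.1)
    [MeasurableSpace ((UnitaryGroup.cmDatum L 2 H).Local v)] [BorelSpace ((UnitaryGroup.cmDatum L 2 H).Local v)]
    (μ : Measure ((UnitaryGroup.cmDatum L 2 H).Local v)) [μ.IsHaarMeasure]
    [MeasurableSpace ↥(unitaryGroupOfForm (galAdicCompletionMap (L := L) (IsCMField.complexConj L) hw) ((StdForm.antidiagonal 2).over (w.1.adicCompletion L)))]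
    [BorelSpace ↥(unitaryGroupOfForm (galAdicCompletionMap (L := L) (IsCMField.complexConj L) hw) ((StdForm.antidiagonal 2).over (w.1.adicCompletion L)))]
    (e : (UnitaryGroup.cmDatum L 2 H).Local v ≃ₜ*
      ↥(unitaryGroupOfForm (galAdicCompletionMap (L := L) (IsCMField.complexConj L) hw) ((StdForm.antidiagonal 2).over (w.1.adicCompletion L))))
    (ΩM : CompactExhaustion ↥(unitaryGroupOfForm (galAdicCompletionMap (L := L) (IsCMField.complexConj L) hw) ((StdForm.antidiagonal 2).over (w.1.adicCompletion L))))
    {ϖ : w.1.adicCompletion L} (hϖ : Valued.v ϖ = WithZero.exp (-1 : ℤ))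
    (hmem : ∀ (m : ℕ) (g : ↥(unitaryGroupOfForm (galAdicCompletionMap (L := L) (IsCMField.complexConj L) hw) ((StdForm.antidiagonal 2).over (w.1.adicCompletion L)))),
      g ∈ ΩM m ↔
      (∀ i j, Valued.v (ϖ ^ m * ((g : GL (Fin 2) (w.1.adicCompletion L)) : Matrix (Fin 2) (Fin 2) (w.1.adicCompletion L)) i j) ≤ 1) ∧
        ∀ i j, Valued.v (ϖ ^ m * (((g : GL (Fin 2) (w.1.adicCompletion L))⁻¹ : GL (Fin 2) (w.1.adicCompletion L)) :
          Matrix (Fin 2) (Fin 2) (w.1.adicCompletion L)) i j) ≤ 1)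
    {V : Type*} [AddCommGroup V] [Module ℂ V] (ρ : Representation ℂ ((UnitaryGroup.cmDatum L 2 H).Local v) V) (hsm : ρ.IsSmooth) (hsc : ρ.IsSupercuspidal)
    (B : V →ₗ⋆[ℂ] V →ₗ[ℂ] ℂ) (hBinv : ∀ (g : (UnitaryGroup.cmDatum L 2 H).Local v) (x y : V), B (ρ g x) (ρ g y) = B x y) (u u' : V)
    (hRD : ∀ (μM : Measure ↥(unitaryGroupOfForm (galAdicCompletionMap (L := L) (IsCMField.complexConj L) hw) ((StdForm.antidiagonal 2).over (w.1.adicCompletion L))))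
      [μM.IsHaarMeasure]
      (ρM : Representation ℂ ↥(unitaryGroupOfForm (galAdicCompletionMap (L := L) (IsCMField.complexConj L) hw) ((StdForm.antidiagonal 2).over (w.1.adicCompletion L))) V),
      ρM.IsSmooth → ρM.IsSupercuspidal →
      (∀ (m : ↥(unitaryGroupOfForm (galAdicCompletionMap (L := L) (IsCMField.complexConj L) hw) ((StdForm.antidiagonal 2).over (w.1.adicCompletion L)))) (x y : V),
        B (ρM m x) (ρM m y) = B x y) →
      ∀ {mθ : ℕ}, (∀ g : ↥(unitaryGroupOfForm (galAdicCompletionMap (L := L) (IsCMField.complexConj L) hw) ((StdForm.antidiagonal 2).over (w.1.adicCompletion L))),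
        B u' (ρM g u) ≠ 0 → g ∈ ΩM mθ) →
      ∀ m : ↥(unitaryGroupOfForm (galAdicCompletionMap (L := L) (IsCMField.complexConj L) hw) ((StdForm.antidiagonal 2).over (w.1.adicCompletion L))),
      ∃ R : ℕ,
        (IsRegularElt (m : GL (Fin 2) (w.1.adicCompletion L)) → ∀ n : ℕ, ∫ x in ΩM n \ ΩM R, B u' (ρM (x * m * x⁻¹) u) ∂μM = 0) ∧
        (IsRegularElt (m : GL (Fin 2) (w.1.adicCompletion L)) →
          ¬ IsCompact ((Subgroup.centralizer ({m} :
              Set ↥(unitaryGroupOfForm (galAdicCompletionMap (L := L) (IsCMField.complexConj L) hw) ((StdForm.antidiagonal 2).over (w.1.adicCompletion L)))) :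
            Subgroup ↥(unitaryGroupOfForm (galAdicCompletionMap (L := L) (IsCMField.complexConj L) hw) ((StdForm.antidiagonal 2).over (w.1.adicCompletion L)))) :
              Set ↥(unitaryGroupOfForm (galAdicCompletionMap (L := L) (IsCMField.complexConj L) hw) ((StdForm.antidiagonal 2).over (w.1.adicCompletion L)))) →
          ∃ (t y₀ : ↥(unitaryGroupOfForm (galAdicCompletionMap (L := L) (IsCMField.complexConj L) hw) ((StdForm.antidiagonal 2).over (w.1.adicCompletion L))))
            (d : Fin 2 → (w.1.adicCompletion L)ˣ) (lam mg : ℕ),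
            glDiagonal 2 (w.1.adicCompletion L) d = (t : GL (Fin 2) (w.1.adicCompletion L)) ∧ IsRegularElt (t : GL (Fin 2) (w.1.adicCompletion L)) ∧
            (∀ i k : Fin 2, i ≠ k → Valued.v (ϖ ^ lam) ≤ Valued.v ((d i : (w.1.adicCompletion L)) - d k)) ∧
            (∀ lam' : ℕ, (∀ i k : Fin 2, i ≠ k → Valued.v (ϖ ^ lam') ≤ Valued.v ((d i : (w.1.adicCompletion L)) - d k)) → lam ≤ lam') ∧
            m ∈ ΩM mg ∧ (∀ m' : ℕ, m ∈ ΩM m' → mg ≤ m') ∧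
            y₀ ∈ ΩM (2 * mg + 2 * lam) ∧ m = y₀ * t * y₀⁻¹ ∧
            R = 5 * (2 * mθ + 2 * lam) + 3 * (2 * mg + 2 * lam) + 1))
    (hSHELL : ∀ (ν : Measure ↥(unitaryGroupOfForm (galAdicCompletionMap (L := L) (IsCMField.complexConj L) hw) ((StdForm.antidiagonal 2).over (w.1.adicCompletion L)))) [ν.IsHaarMeasure] (mθ : ℕ),
      ∃ C : ℝ≥0, ∀ (θ : ↥(unitaryGroupOfForm (galAdicCompletionMap (L := L) (IsCMField.complexConj L) hw) ((StdForm.antidiagonal 2).over (w.1.adicCompletion L))) → ℂ), Continuous θ → (∀ g, θ g ≠ 0 → g ∈ ΩM mθ) →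
      ∀ (M : ℝ≥0), (∀ g, ‖θ g‖₊ ≤ M) →
      ∀ (t : ↥(torusU (galAdicCompletionMap (L := L) (IsCMField.complexConj L) hw) ((StdForm.antidiagonal 2).over (w.1.adicCompletion L)))) (d : Fin 2 → (w.1.adicCompletion L)ˣ),
        glDiagonal 2 (w.1.adicCompletion L) d = ((t : ↥(unitaryGroupOfForm (galAdicCompletionMap (L := L) (IsCMField.complexConj L) hw) ((StdForm.antidiagonal 2).over (w.1.adicCompletion L)))) : GL (Fin 2) (w.1.adicCompletion L)) →
        ∀ (g y : ↥(unitaryGroupOfForm (galAdicCompletionMap (L := L) (IsCMField.complexConj L) hw) ((StdForm.antidiagonal 2).over (w.1.adicCompletion L)))) (m : ℕ), g ∈ ΩM m →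
          g = y * (t : ↥(unitaryGroupOfForm (galAdicCompletionMap (L := L) (IsCMField.complexConj L) hw) ((StdForm.antidiagonal 2).over (w.1.adicCompletion L)))) * y⁻¹ →
        ∀ (τ : ℕ), normAbs (w.1.adicCompletion L) ϖ ^ τ ≤ NNReal.sqrt (NNReal.sqrt
            (normAbs (w.1.adicCompletion L) (((g : GL (Fin 2) (w.1.adicCompletion L)) : Matrix (Fin 2) (Fin 2) (w.1.adicCompletion L))).charpoly.discr *
              (normAbs (w.1.adicCompletion L) (((g : GL (Fin 2) (w.1.adicCompletion L)) : Matrix (Fin 2) (Fin 2) (w.1.adicCompletion L))).det ^ 2)⁻¹)) → ∀ (R : ℕ),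
          ∫ x in ΩM R, ‖θ (x * g * x⁻¹)‖ ∂ν ≤
            C * M * ((2 * (R + 42 * m + 2 * mθ + 16 * τ) + 1 : ℕ) : ℝ) * ((residueFieldCard (w.1.adicCompletion L) : ℝ≥0) : ℝ) ^ m *
              ((NNReal.sqrt (NNReal.sqrt
                (normAbs (w.1.adicCompletion L) (((g : GL (Fin 2) (w.1.adicCompletion L)) : Matrix (Fin 2) (Fin 2) (w.1.adicCompletion L))).charpoly.discr *
                  (normAbs (w.1.adicCompletion L) (((g : GL (Fin 2) (w.1.adicCompletion L)) : Matrix (Fin 2) (Fin 2) (w.1.adicCompletion L))).det ^ 2)⁻¹)))⁻¹ : ℝ)) :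
    ∃ (Ω : CompactExhaustion ((UnitaryGroup.cmDatum L 2 H).Local v)) (R : (UnitaryGroup.cmDatum L 2 H).Local v → ℕ) (mθ : ℕ)
      (F : (UnitaryGroup.cmDatum L 2 H).Local v → ℂ) (Bset : (UnitaryGroup.cmDatum L 2 H).Local v → Set ((UnitaryGroup.cmDatum L 2 H).Local v)) (C M : ℝ≥0),
      (∀ n : ℕ, (Ω n : Set ((UnitaryGroup.cmDatum L 2 H).Local v)) = e ⁻¹' (ΩM n)) ∧
      (∀ g, Bset g = e ⁻¹' (ΩM (R g))) ∧ (∀ g, IsCompact (Bset g)) ∧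
      -- `hlim` of ★ p856184 and `hcanc` of ★ p856355, token for token
      (∀ᵐ g ∂μ, ¬ (IsRegularElt (g.val : GL (Fin 2) (UnitaryGroup.LocalRing L v)) ∧
          IsCompact ((Subgroup.centralizer ({g} : Set ((UnitaryGroup.cmDatum L 2 H).Local v))) : Set ((UnitaryGroup.cmDatum L 2 H).Local v))) →
        Tendsto (fun n => ∫ x in Ω n, B u' (ρ (x * g * x⁻¹) u) ∂μ) atTop (𝓝 (F g))) ∧
      (∀ n : ℕ, ∀ᵐ g ∂μ, ¬ (IsRegularElt (g.val : GL (Fin 2) (UnitaryGroup.LocalRing L v)) ∧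
          IsCompact ((Subgroup.centralizer ({g} : Set ((UnitaryGroup.cmDatum L 2 H).Local v))) : Set ((UnitaryGroup.cmDatum L 2 H).Local v))) →
        ∫ x in Ω n, B u' (ρ (x * g * x⁻¹) u) ∂μ = ∫ x in Ω n ∩ Bset g, B u' (ρ (x * g * x⁻¹) u) ∂μ) ∧
      -- support height and bound of `θ_M = θ ∘ e⁻¹`, a.e. regularity of `e g`
      (∀ m' : ↥(unitaryGroupOfForm (galAdicCompletionMap (L := L) (IsCMField.complexConj L) hw) ((StdForm.antidiagonal 2).over (w.1.adicCompletion L))),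
        B u' (ρ (e.symm m') u) ≠ 0 → m' ∈ ΩM mθ) ∧
      (∀ m' : ↥(unitaryGroupOfForm (galAdicCompletionMap (L := L) (IsCMField.complexConj L) hw) ((StdForm.antidiagonal 2).over (w.1.adicCompletion L))),
        ‖B u' (ρ (e.symm m') u)‖₊ ≤ M) ∧
      (∀ᵐ g ∂μ, IsRegularElt ((e g : ↥(unitaryGroupOfForm (galAdicCompletionMap (L := L) (IsCMField.complexConj L) hw)
          ((StdForm.antidiagonal 2).over (w.1.adicCompletion L)))) : GL (Fin 2) (w.1.adicCompletion L))) ∧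
      -- `hball_of_model_bound` and `hballE_of_model_bound` (`W := W_M ∘ e`), as ★ FILE B
      (∀ W_M : ↥(unitaryGroupOfForm (galAdicCompletionMap (L := L) (IsCMField.complexConj L) hw) ((StdForm.antidiagonal 2).over (w.1.adicCompletion L))) → ℝ,
        (∀ᵐ g ∂μ, ¬ (IsRegularElt (g.val : GL (Fin 2) (UnitaryGroup.LocalRing L v)) ∧
            IsCompact ((Subgroup.centralizer ({g} : Set ((UnitaryGroup.cmDatum L 2 H).Local v))) : Set ((UnitaryGroup.cmDatum L 2 H).Local v))) →
          ∫ x' in ΩM (R g), ‖B u' (ρ (e.symm (x' * e g * x'⁻¹)) u)‖ ∂(μ.map e) ≤ W_M (e g)) →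
        ∀ᵐ g ∂μ, ¬ (IsRegularElt (g.val : GL (Fin 2) (UnitaryGroup.LocalRing L v)) ∧
            IsCompact ((Subgroup.centralizer ({g} : Set ((UnitaryGroup.cmDatum L 2 H).Local v))) : Set ((UnitaryGroup.cmDatum L 2 H).Local v))) →
          ∫ x in Bset g, ‖B u' (ρ (x * g * x⁻¹) u)‖ ∂μ ≤ W_M (e g)) ∧
      (∀ W_M : ↥(unitaryGroupOfForm (galAdicCompletionMap (L := L) (IsCMField.complexConj L) hw) ((StdForm.antidiagonal 2).over (w.1.adicCompletion L))) → ℝ,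
        (∀ᵐ g ∂μ, (IsRegularElt (g.val : GL (Fin 2) (UnitaryGroup.LocalRing L v)) ∧
            IsCompact ((Subgroup.centralizer ({g} : Set ((UnitaryGroup.cmDatum L 2 H).Local v))) : Set ((UnitaryGroup.cmDatum L 2 H).Local v))) →
          ∫ x', ‖B u' (ρ (e.symm (x' * e g * x'⁻¹)) u)‖ ∂(μ.map e) ≤ W_M (e g)) →
        ∀ᵐ g ∂μ, (IsRegularElt (g.val : GL (Fin 2) (UnitaryGroup.LocalRing L v)) ∧
            IsCompact ((Subgroup.centralizer ({g} : Set ((UnitaryGroup.cmDatum L 2 H).Local v))) : Set ((UnitaryGroup.cmDatum L 2 H).Local v))) →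
          ∫ x, ‖B u' (ρ (x * g * x⁻¹) u)‖ ∂μ ≤ W_M (e g)) ∧
      -- THE SPLIT BALL BOUND, explicit shell weight (★ (M5e-1‴) at the place, for the chosen ball)
      (∀ g : (UnitaryGroup.cmDatum L 2 H).Local v, IsRegularElt ((e g : ↥(unitaryGroupOfForm (galAdicCompletionMap (L := L) (IsCMField.complexConj L) hw)
          ((StdForm.antidiagonal 2).over (w.1.adicCompletion L)))) : GL (Fin 2) (w.1.adicCompletion L)) →
        ¬ IsCompact ((Subgroup.centralizer ({g} : Set ((UnitaryGroup.cmDatum L 2 H).Local v))) : Set ((UnitaryGroup.cmDatum L 2 H).Local v)) →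
        ∀ τ : ℕ, normAbs (w.1.adicCompletion L) ϖ ^ τ ≤ NNReal.sqrt (NNReal.sqrt
            (normAbs (w.1.adicCompletion L) ((((e g : ↥(unitaryGroupOfForm (galAdicCompletionMap (L := L) (IsCMField.complexConj L) hw)
                ((StdForm.antidiagonal 2).over (w.1.adicCompletion L)))) : GL (Fin 2) (w.1.adicCompletion L)) : Matrix (Fin 2) (Fin 2) (w.1.adicCompletion L))).charpoly.discr *
              (normAbs (w.1.adicCompletion L) ((((e g : ↥(unitaryGroupOfForm (galAdicCompletionMap (L := L) (IsCMField.complexConj L) hw)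
                ((StdForm.antidiagonal 2).over (w.1.adicCompletion L)))) : GL (Fin 2) (w.1.adicCompletion L)) : Matrix (Fin 2) (Fin 2) (w.1.adicCompletion L))).det ^ 2)⁻¹)) →
          ∫ x in Bset g, ‖B u' (ρ (x * g * x⁻¹) u)‖ ∂μ ≤
            C * M * ((2 * (12 * mθ + 208 * ΩM.find (e g) + 80 * τ + 1) + 1 : ℕ) : ℝ) *
              ((residueFieldCard (w.1.adicCompletion L) : ℝ≥0) : ℝ) ^ (ΩM.find (e g)) *
              ((NNReal.sqrt (NNReal.sqrt
                (normAbs (w.1.adicCompletion L) ((((e g : ↥(unitaryGroupOfForm (galAdicCompletionMap (L := L) (IsCMField.complexConj L) hw)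
                    ((StdForm.antidiagonal 2).over (w.1.adicCompletion L)))) : GL (Fin 2) (w.1.adicCompletion L)) : Matrix (Fin 2) (Fin 2) (w.1.adicCompletion L))).charpoly.discr *
                  (normAbs (w.1.adicCompletion L) ((((e g : ↥(unitaryGroupOfForm (galAdicCompletionMap (L := L) (IsCMField.complexConj L) hw)
                    ((StdForm.antidiagonal 2).over (w.1.adicCompletion L)))) : GL (Fin 2) (w.1.adicCompletion L)) : Matrix (Fin 2) (Fin 2) (w.1.adicCompletion L))).det ^ 2)⁻¹)))⁻¹ : ℝ)) := by
  -- ★ [M6′]₂ FILE B MAIN (K2E1-p10): `Ω`, `R`, `m_θ`, the shapes, the datum, a.e. regularity, the transport identity — over the letter `hRD`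
  obtain ⟨Ω, R, mθ, hΩ, hθ, hae, hdat, hregae, htrans⟩ :=
    K2E3SupercuspidalTruncatedCharLimCancExplicitTwo.exists_explicit_exhaustion_radius L H w hw μ e ΩM ρ hsm hsc B hBinv u u' hRD
  have hBset : ∀ g, (Ω (R g) : Set ((UnitaryGroup.cmDatum L 2 H).Local v)) = e ⁻¹' (ΩM (R g)) := fun g => hΩ (R g)
  -- the model coefficient `θ_M`: continuous, supported in `Ω_M m_θ`, hence bounded
  have hθMc : Continuous fun m' : ↥(unitaryGroupOfForm (galAdicCompletionMap (L := L) (IsCMField.complexConj L) hw) ((StdForm.antidiagonal 2).over (w.1.adicCompletion L))) =>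
      B u' (ρ (e.symm m') u) := (Representation.continuous_sesqForm_apply_apply (hsm u) u').comp e.symm.continuous
  have hθMcs : HasCompactSupport fun m' : ↥(unitaryGroupOfForm (galAdicCompletionMap (L := L) (IsCMField.complexConj L) hw) ((StdForm.antidiagonal 2).over (w.1.adicCompletion L))) => B u' (ρ (e.symm m') u) :=
    HasCompactSupport.intro (ΩM.isCompact mθ) fun m' hm' => not_not.1 fun h => hm' (hθ m' h)
  obtain ⟨M₀, hM₀⟩ := hθMcs.exists_bound_of_continuous hθMc
  have hMb : ∀ m' : ↥(unitaryGroupOfForm (galAdicCompletionMap (L := L) (IsCMField.complexConj L) hw) ((StdForm.antidiagonal 2).over (w.1.adicCompletion L))),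
      ‖B u' (ρ (e.symm m') u)‖₊ ≤ Real.toNNReal M₀ := fun m' => by
    rw [← NNReal.coe_le_coe, coe_nnnorm]
    exact (hM₀ m').trans (Real.le_coe_toNNReal M₀)
  -- `e_* μ` is a Haar measure on the model; `σ_w` is isometric
  haveI : (μ.map e).IsHaarMeasure := ContinuousMulEquiv.isHaarMeasure_map μ e
  have hσv : ∀ x, Valued.v (galAdicCompletionMap (L := L) (IsCMField.complexConj L) hw x) = Valued.v x :=
    fun x => valued_galAdicCompletionMap (L := L) (IsCMField.complexConj L) hw x
  -- the shell letter at `(e_* μ, m_θ)`: ONE constant for `m_θ`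
  obtain ⟨C, hC⟩ := hSHELL (μ.map e) mθ
  refine ⟨Ω, R, mθ, fun g => ∫ x in Ω (R g), B u' (ρ (x * g * x⁻¹) u) ∂μ, fun g => Ω (R g), C, Real.toNNReal M₀, hΩ, hBset, fun g => Ω.isCompact (R g), ?_, fun n => ?_,
    hθ, hMb, hregae, fun W_M hWM => ?_, fun W_M hWM => ?_, fun g hreg hZ τ hτ => ?_⟩
  · filter_upwards [hae] with g hg _
    exact hg.2
  · filter_upwards [hae] with g hg _
    exact hg.1 n
  · filter_upwards [hWM] with g hg hng
    rw [hBset g, htrans g]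
    exact hg hng
  · filter_upwards [hWM] with g hg hell
    have h := htrans g Set.univ
    rw [Set.preimage_univ, Measure.restrict_univ, Measure.restrict_univ] at h
    rw [h]
    exact hg hell
  · -- the datum at `e g` and `m_g = h(e g)`
    obtain ⟨t, y₀, d, lam, mg, hd, -, -, hlam_min, hgm, hmg_min, -, hgy, hR⟩ := hdat g hreg hZ
    have hmg : mg = ΩM.find (e g) := le_antisymm (hmg_min _ (ΩM.mem_find _)) (ΩM.mem_iff_find_le.1 hgm)
    subst hmg
    have htT : t ∈ torusU (galAdicCompletionMap (L := L) (IsCMField.complexConj L) hw) ((StdForm.antidiagonal 2).over (w.1.adicCompletion L)) :=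
      (mem_torusU_iff t).2 ⟨d, hd⟩
    -- the torus entries on `Ω_M m_g` (★ (D2)₂ `mem_heightBall_torus_of_conj_mem`), then ★ (M5e-2)₂: the depth of `t` on the shell is `≤ 4τ + 4 m_g`
    have hgt : y₀ * t * y₀⁻¹ ∈ ΩM (ΩM.find (e g)) := by rw [← hgy]; exact hgm
    have htΩ : t ∈ (⇑ΩM) (ΩM.find (e g)) :=
      K2E3ConjugatorHeightControlRankOneTwo.mem_heightBall_torus_of_conj_mem (galAdicCompletionMap (L := L) (IsCMField.complexConj L) hw) hσv rfl (⇑ΩM) hmem hd hgt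
    have hdm' : ∀ i : Fin 2, Valued.v (ϖ ^ ΩM.find (e g) * ((d i : (w.1.adicCompletion L)))⁻¹) ≤ 1 := fun i => by
      have h := ((hmem _ t).1 htΩ).2 i i
      rwa [← hd, K2E3CuspFormCancellationU3Torus.coe_inv_glDiagonal, Matrix.diagonal_apply_eq] at h
    have hcoe : ((e g : ↥(unitaryGroupOfForm (galAdicCompletionMap (L := L) (IsCMField.complexConj L) hw) ((StdForm.antidiagonal 2).over (w.1.adicCompletion L)))) :
        GL (Fin 2) (w.1.adicCompletion L)) =
        (y₀ : GL (Fin 2) (w.1.adicCompletion L)) * (glDiagonal 2 (w.1.adicCompletion L) d : GL (Fin 2) (w.1.adicCompletion L)) * (y₀ : GL (Fin 2) (w.1.adicCompletion L))⁻¹ := by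
      rw [hgy, hd]; rfl
    have hchar : ((((e g : ↥(unitaryGroupOfForm (galAdicCompletionMap (L := L) (IsCMField.complexConj L) hw) ((StdForm.antidiagonal 2).over (w.1.adicCompletion L)))) :
        GL (Fin 2) (w.1.adicCompletion L)) : Matrix (Fin 2) (Fin 2) (w.1.adicCompletion L))).charpoly =
        (((glDiagonal 2 (w.1.adicCompletion L) d : GL (Fin 2) (w.1.adicCompletion L)) : Matrix (Fin 2) (Fin 2) (w.1.adicCompletion L))).charpoly := by
      rw [hcoe, Units.val_mul, Units.val_mul, Matrix.coe_units_inv]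
      exact Matrix.charpoly_units_conj (y₀ : GL (Fin 2) (w.1.adicCompletion L)) _
    have hdet : ((((e g : ↥(unitaryGroupOfForm (galAdicCompletionMap (L := L) (IsCMField.complexConj L) hw) ((StdForm.antidiagonal 2).over (w.1.adicCompletion L)))) :
        GL (Fin 2) (w.1.adicCompletion L)) : Matrix (Fin 2) (Fin 2) (w.1.adicCompletion L))).det =
        (((glDiagonal 2 (w.1.adicCompletion L) d : GL (Fin 2) (w.1.adicCompletion L)) : Matrix (Fin 2) (Fin 2) (w.1.adicCompletion L))).det := by
      rw [hcoe, Units.val_mul, Units.val_mul]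
      exact Matrix.det_units_conj (y₀ : GL (Fin 2) (w.1.adicCompletion L)) _
    have hτ' := hτ
    rw [hchar, hdet] at hτ'
    have hdepth : ∀ i k : Fin 2, i ≠ k → Valued.v (ϖ ^ (4 * τ + 4 * ΩM.find (e g))) ≤ Valued.v ((d i : (w.1.adicCompletion L)) - d k) := fun i k hik =>
      K2E3SplitTorusDepthFromDiscriminantTwo.v_pow_le_v_sub_of_pow_normAbs_le_token hϖ hdm' hτ' hik
    have hlam : lam ≤ 4 * τ + 4 * ΩM.find (e g) := hlam_min _ hdepth
    -- `2(R g + 42 h + 2 m_θ + 16 τ) + 1 ≤ 2(12 m_θ + 112 h + 80 τ + 1) + 1 ≤ 2(12 m_θ + 208 h + 80 τ + 1) + 1` (the frozen `N = 3` constant)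
    have hN : (2 * (R g + 42 * ΩM.find (e g) + 2 * mθ + 16 * τ) + 1 : ℕ) ≤ 2 * (12 * mθ + 208 * ΩM.find (e g) + 80 * τ + 1) + 1 := by
      rw [hR]; omega
    have hN' := (Nat.cast_le (α := ℝ)).2 hN
    -- the shell bound on `M` at `(θ_M, ⟨t⟩, d, e g, y₀, m_g, τ, R g)`, transported to `G`
    have hshell := hC (fun m' => B u' (ρ (e.symm m') u)) hθMc hθ (Real.toNNReal M₀) hMb ⟨t, htT⟩ d hd (e g) y₀ (ΩM.find (e g)) hgm hgy τ hτ (R g)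
    dsimp only
    rw [hBset g, htrans g]
    refine hshell.trans ?_
    have h1 : (0 : ℝ) ≤ (C : ℝ) * (Real.toNNReal M₀ : ℝ) := mul_nonneg C.2 (Real.toNNReal M₀).2
    have h2 : (0 : ℝ) ≤ ((residueFieldCard (w.1.adicCompletion L) : ℝ≥0) : ℝ) ^ ΩM.find (e g) := pow_nonneg (NNReal.coe_nonneg _) _
    exact mul_le_mul_of_nonneg_right (mul_le_mul_of_nonneg_right (mul_le_mul_of_nonneg_left hN' h1) h2) (inv_nonneg.2 (NNReal.coe_nonneg _))

end Summit.HodgeConjecture.HodgeConjecture.Cruxes.H413.K2E3SupercuspidalTruncatedCharSplitBallPlaceTwo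

end
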